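import Mathlib
import Summits.Ventures.PercRepro2.Defs
import Summits.Ventures.PercRepro2.Graph
import Summits.Ventures.PercRepro2.OneColourSwitch
import Summits.Ventures.PercRepro2.RegionHubSign
import Summits.Ventures.PercRepro2.SideSwitch

/-!
# The fibration of `Sep` over the representatives, and the outside flip (blind cell PercRepro2,
p3 g18, 2026-08-27; `proofs/P3-CPNC.md` §15c–d)

With `A0 = (K₂ ∪ M₂) ∖ {r, s}` the sided vertices, the representatives `Rep` are the
`Sep`-colourings with every sided vertex on the `Y`-side (`M₂ ⊆ {r, s}`); a side assignment
`T ⊆ A0` of a representative `ρ` is `assign T ρ = ρ ⊕ touches T`.  When no two non-marks are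
adjacent and no non-mark lies in both worlds (`DZero`), `(ρ, T) ↦ assign T ρ` is a bijection
`Rep × 2^{A0} → Sep` (`sum_sep_eq_sum_rep`).  The outside flip `flipIn (Oset ω) ω` (flip the
edges inside `O = V ∖ (K₂ ∪ M₂)`) preserves the worlds, `Sep`, the representatives and `σ_rs`.
Own work; std axioms.
-/

namespace Summit.Ventures.PercRepro2

namespace SideSwitch

open Finset Classical RegionHub OneColourSwitch

variable {V : Type*} {E : Type*}
variable {ends : E → Sym2 V}

/-! ## The fibration of `Sep` over the representatives -/

/-- `U₂` is preserved by the side switch. -/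
lemma U2_flipTouch {p q r s : V} {ω : Config E} (hno : NoNonmarkEdge ends p q r s)
    (h : sep2 ends p q r s ω) {C : Set V} (hC : C ⊆ K2 ends r s ω ∪ M2 ends r s ω)
    (hCr : r ∉ C) (hCs : s ∉ C) :
    K2 ends r s (flipTouch ends C ω) ∪ M2 ends r s (flipTouch ends C ω) =
      K2 ends r s ω ∪ M2 ends r s ω := by
  rw [K2_flipTouch hno h hC hCr hCs, M2_flipTouch hno h hC hCr hCs]
  ext x
  constructor
  · rintro ((⟨hx, _⟩ | ⟨_, hx⟩) | (⟨hx, _⟩ | ⟨_, hx⟩))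
    · exact Or.inl hx
    · exact Or.inr hx
    · exact Or.inr hx
    · exact Or.inl hx
  · intro hx
    by_cases hxC : x ∈ C
    · rcases hx with hx | hx
      · exact Or.inr (Or.inr ⟨hxC, hx⟩)
      · exact Or.inl (Or.inr ⟨hxC, hx⟩)
    · rcases hx with hx | hx
      · exact Or.inl (Or.inl ⟨hx, hxC⟩)
      · exact Or.inr (Or.inl ⟨hx, hxC⟩)

/-! ## The outside flip -/

variable (ends)

/-- Flip the colour of every edge inside the vertex set `S`. -/
noncomputable def flipIn (S : Set V) (ω : Config E) : Config E :=
  fun e => if e ∈ within ends S then !ω e else ω e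

/-- The outside of `U₂`. -/
def Oset (r s : V) (ω : Config E) : Set V := (K2 ends r s ω ∪ M2 ends r s ω)ᶜ

variable {ends}

/-- `flipIn` on an edge inside `S`. -/
lemma flipIn_of_mem {S : Set V} {ω : Config E} {e : E} (h : e ∈ within ends S) :
    flipIn ends S ω e = !ω e := by simp [flipIn, h]

/-- `flipIn` on an edge not inside `S`. -/
lemma flipIn_of_notMem {S : Set V} {ω : Config E} {e : E} (h : e ∉ within ends S) :
    flipIn ends S ω e = ω e := by simp [flipIn, h]

/-- `flipIn S` is an involution. -/
lemma flipIn_flipIn (S : Set V) (ω : Config E) : flipIn ends S (flipIn ends S ω) = ω := by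
  funext e
  by_cases h : e ∈ within ends S
  · rw [flipIn_of_mem h, flipIn_of_mem h, Bool.not_not]
  · rw [flipIn_of_notMem h, flipIn_of_notMem h]

/-- The colour flip commutes with `flipIn`. -/
lemma compl_flipIn (S : Set V) (ω : Config E) :
    OneColourSwitch.compl (flipIn ends S ω) = flipIn ends S (OneColourSwitch.compl ω) := by
  funext e
  by_cases h : e ∈ within ends S
  · simp [OneColourSwitch.compl, flipIn_of_mem h]
  · simp [OneColourSwitch.compl, flipIn_of_notMem h]

/-- The two flips commute. -/
lemma flipIn_flipTouch (S C : Set V) (ω : Config E) :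
    flipIn ends S (flipTouch ends C ω) = flipTouch ends C (flipIn ends S ω) := by
  funext e
  by_cases h1 : e ∈ within ends S <;> by_cases h2 : e ∈ touches ends C <;>
    simp [flipIn, flipTouch, h1, h2]

/-- The outside is invariant under the colour flip. -/
lemma Oset_compl (r s : V) (ω : Config E) :
    Oset ends r s (OneColourSwitch.compl ω) = Oset ends r s ω := by
  simp only [Oset, K2_compl, M2_compl, Set.union_comm]

/-- An edge touching `U₂` is not inside the outside. -/
lemma not_mem_within_Oset_of_mem_touches {r s : V} {ω : Config E} {e : E}
    (he : e ∈ touches ends (K2 ends r s ω ∪ M2 ends r s ω)) :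
    e ∉ within ends (Oset ends r s ω) := by
  rintro ⟨x, hx, y, hy, hends⟩
  obtain ⟨z, hz, w, hzw⟩ := he
  rw [hends, Sym2.eq_iff] at hzw
  rcases hzw with ⟨rfl, _⟩ | ⟨_, rfl⟩
  · exact hx hz
  · exact hy hz

/-- The `Y`-world ignores the edges inside the outside. -/
lemma K2_flipIn_Oset (r s : V) (ω : Config E) :
    K2 ends r s (flipIn ends (Oset ends r s ω) ω) = K2 ends r s ω := by
  apply expl_eq_of_eqOn_touches
  intro e he
  obtain ⟨x, hx, y, hxy⟩ := he
  have hnot : e ∉ within ends (Oset ends r s ω) :=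
    not_mem_within_Oset_of_mem_touches ⟨x, Or.inl hx, y, hxy⟩
  rw [flipIn_of_notMem hnot]

/-- The `W`-world ignores the edges inside the outside. -/
lemma M2_flipIn_Oset (r s : V) (ω : Config E) :
    M2 ends r s (flipIn ends (Oset ends r s ω) ω) = M2 ends r s ω := by
  rw [M2, compl_flipIn, ← K2, ← Oset_compl, K2_flipIn_Oset, K2_compl]

/-- The outside is preserved by the outside flip. -/
lemma Oset_flipIn (r s : V) (ω : Config E) :
    Oset ends r s (flipIn ends (Oset ends r s ω) ω) = Oset ends r s ω := by
  show (K2 ends r s (flipIn ends (Oset ends r s ω) ω) ∪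
    M2 ends r s (flipIn ends (Oset ends r s ω) ω))ᶜ = Oset ends r s ω
  rw [K2_flipIn_Oset, M2_flipIn_Oset]
  rfl

/-- The cluster of `r` ignores the edges inside the outside. -/
lemma cluster_r_flipIn_Oset (r s : V) (ω : Config E) :
    cluster ends (flipIn ends (Oset ends r s ω) ω) r = cluster ends ω r := by
  refine cluster_eq_of_eqOn_touches (ω := ω) ?_ rfl
  intro e he
  obtain ⟨x, hx, y, hxy⟩ := he
  have hxK : x ∈ K2 ends r s ω := mem_K2_iff.2 (Or.inl hx)
  have hnot : e ∉ within ends (Oset ends r s ω) :=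
    not_mem_within_Oset_of_mem_touches ⟨x, Or.inl hxK, y, hxy⟩
  rw [flipIn_of_notMem hnot]

/-- `r ~_Y s` ignores the edges inside the outside. -/
lemma conn_rs_flipIn_Oset (r s : V) (ω : Config E) :
    Conn ends (flipIn ends (Oset ends r s ω) ω) r s ↔ Conn ends ω r s := by
  have h := cluster_r_flipIn_Oset (ends := ends) r s ω
  constructor
  · intro hc
    have : s ∈ cluster ends (flipIn ends (Oset ends r s ω) ω) r := hc
    rw [h] at this
    exact this
  · intro hc
    have : s ∈ cluster ends ω r := hc
    rw [← h] at this
    exact this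

/-- `r ~_W s` ignores the edges inside the outside. -/
lemma conn_rs_compl_flipIn_Oset (r s : V) (ω : Config E) :
    Conn ends (OneColourSwitch.compl (flipIn ends (Oset ends r s ω) ω)) r s ↔
      Conn ends (OneColourSwitch.compl ω) r s := by
  rw [compl_flipIn, ← Oset_compl]
  exact conn_rs_flipIn_Oset r s (OneColourSwitch.compl ω)

/-- `σ_rs` ignores the edges inside the outside. -/
lemma sigma_rs_flipIn_Oset (r s : V) (ω : Config E) :
    sigma ends (flipIn ends (Oset ends r s ω) ω) r s = sigma ends ω r s := by
  unfold sigma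
  simp only [conn_rs_flipIn_Oset, conn_rs_compl_flipIn_Oset]


section Count

variable [Fintype V] [DecidableEq V] [Fintype E] [DecidableEq E]

variable (ends)

/-- The non-marks of `U₂` (the vertices that carry a side). -/
noncomputable def A0 (r s : V) (ω : Config E) : Finset V :=
  univ.filter (fun x => (x ∈ K2 ends r s ω ∪ M2 ends r s ω) ∧ x ≠ r ∧ x ≠ s)

/-- The `W`-side: the non-marks of the `W`-world. -/
noncomputable def Bside (r s : V) (ω : Config E) : Finset V :=
  univ.filter (fun x => x ∈ M2 ends r s ω ∧ x ≠ r ∧ x ≠ s)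

/-- The `Sep`-colourings. -/
noncomputable def SepSet (p q r s : V) : Finset (Config E) :=
  univ.filter (fun ω => sep2 ends p q r s ω)

/-- The representatives: `Sep`-colourings with every non-mark of `U₂` on the `Y`-side. -/
noncomputable def Rep (p q r s : V) : Finset (Config E) :=
  univ.filter (fun ω => sep2 ends p q r s ω ∧ ∀ x ∈ M2 ends r s ω, x = r ∨ x = s)

/-- The normalisation: switch the whole `W`-side to the `Y`-side. -/
noncomputable def nu (r s : V) (ω : Config E) : Config E :=
  flipTouch ends (↑(Bside ends r s ω) : Set V) ω

/-- The colouring with the side assignment `T` (the vertices of `T` on the `W`-side). -/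
noncomputable def assign (T : Finset V) (ρ : Config E) : Config E :=
  flipTouch ends (↑T : Set V) ρ

variable {ends}

omit [Fintype E] [DecidableEq E] in
/-- Membership in `A0`. -/
lemma mem_A0 {r s : V} {ω : Config E} {x : V} :
    x ∈ A0 ends r s ω ↔ (x ∈ K2 ends r s ω ∪ M2 ends r s ω) ∧ x ≠ r ∧ x ≠ s := by
  simp [A0]

omit [Fintype E] [DecidableEq E] in
/-- Membership in the `W`-side. -/
lemma mem_Bside {r s : V} {ω : Config E} {x : V} :
    x ∈ Bside ends r s ω ↔ x ∈ M2 ends r s ω ∧ x ≠ r ∧ x ≠ s := by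
  simp [Bside]

omit [Fintype V] [DecidableEq V] in
/-- Membership in the `Sep`-colourings. -/
lemma mem_SepSet {p q r s : V} {ω : Config E} :
    ω ∈ SepSet ends p q r s ↔ sep2 ends p q r s ω := by
  simp [SepSet]

/-- Membership in the representatives. -/
lemma mem_Rep {p q r s : V} {ω : Config E} :
    ω ∈ Rep ends p q r s ↔ sep2 ends p q r s ω ∧ ∀ x ∈ M2 ends r s ω, x = r ∨ x = s := by
  simp [Rep]

omit [Fintype E] [DecidableEq E] in
/-- The `W`-side is a set of sided vertices. -/
lemma Bside_subset_A0 (r s : V) (ω : Config E) : Bside ends r s ω ⊆ A0 ends r s ω := by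
  intro x hx
  rw [mem_Bside] at hx
  exact mem_A0.2 ⟨Or.inr hx.1, hx.2⟩

omit [Fintype E] [DecidableEq E] in
/-- The hypotheses of the switch lemma for a subset of `A0`. -/
lemma subset_U2_of_subset_A0 {r s : V} {ω : Config E} {T : Finset V} (hT : T ⊆ A0 ends r s ω) :
    (↑T : Set V) ⊆ K2 ends r s ω ∪ M2 ends r s ω ∧ r ∉ (↑T : Set V) ∧ s ∉ (↑T : Set V) := by
  refine ⟨fun x hx => (mem_A0.1 (hT hx)).1, fun hr => ?_, fun hs => ?_⟩
  · exact (mem_A0.1 (hT hr)).2.1 rfl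
  · exact (mem_A0.1 (hT hs)).2.2 rfl

omit [Fintype E] [DecidableEq E] in
/-- `A0` is preserved by a side switch of a subset of `A0`. -/
lemma A0_assign {p q r s : V} {ρ : Config E} (hno : NoNonmarkEdge ends p q r s)
    (h : sep2 ends p q r s ρ) {T : Finset V} (hT : T ⊆ A0 ends r s ρ) :
    A0 ends r s (assign ends T ρ) = A0 ends r s ρ := by
  obtain ⟨hC, hCr, hCs⟩ := subset_U2_of_subset_A0 hT
  ext x
  simp only [mem_A0, assign]
  rw [U2_flipTouch hno h hC hCr hCs]

omit [Fintype E] [DecidableEq E] in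
/-- A side assignment of a representative is a `Sep`-colouring. -/
lemma sep2_assign {p q r s : V} {ρ : Config E} (hno : NoNonmarkEdge ends p q r s)
    (h : sep2 ends p q r s ρ) {T : Finset V} (hT : T ⊆ A0 ends r s ρ) :
    sep2 ends p q r s (assign ends T ρ) := by
  obtain ⟨hC, hCr, hCs⟩ := subset_U2_of_subset_A0 hT
  exact sep2_flipTouch hno h hC hCr hCs

/-- For a representative, `A0 ⊆ K₂`. -/
lemma A0_subset_K2_of_mem_Rep {p q r s : V} {ρ : Config E} (hρ : ρ ∈ Rep ends p q r s) {x : V}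
    (hx : x ∈ A0 ends r s ρ) : x ∈ K2 ends r s ρ := by
  obtain ⟨_, hM⟩ := mem_Rep.1 hρ
  obtain ⟨hU, hr, hs⟩ := mem_A0.1 hx
  rcases hU with hK | hM'
  · exact hK
  · rcases hM x hM' with h' | h'
    · exact (hr h').elim
    · exact (hs h').elim

/-- The `W`-side of a side assignment of a representative is the assigned set. -/
lemma Bside_assign {p q r s : V} {ρ : Config E} (hno : NoNonmarkEdge ends p q r s)
    (hρ : ρ ∈ Rep ends p q r s) {T : Finset V} (hT : T ⊆ A0 ends r s ρ) :
    Bside ends r s (assign ends T ρ) = T := by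
  obtain ⟨h, hM⟩ := mem_Rep.1 hρ
  obtain ⟨hC, hCr, hCs⟩ := subset_U2_of_subset_A0 hT
  ext x
  simp only [mem_Bside, assign]
  rw [M2_flipTouch hno h hC hCr hCs]
  constructor
  · rintro ⟨(⟨hxM, _⟩ | ⟨hxT, _⟩), hr, hs⟩
    · rcases hM x hxM with h' | h'
      · exact (hr h').elim
      · exact (hs h').elim
    · exact hxT
  · intro hxT
    refine ⟨Or.inr ⟨hxT, A0_subset_K2_of_mem_Rep hρ (hT hxT)⟩, ?_, ?_⟩
    · rintro rfl; exact hCr hxT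
    · rintro rfl; exact hCs hxT

/-- `nu` of a side assignment of a representative is the representative. -/
lemma nu_assign {p q r s : V} {ρ : Config E} (hno : NoNonmarkEdge ends p q r s)
    (hρ : ρ ∈ Rep ends p q r s) {T : Finset V} (hT : T ⊆ A0 ends r s ρ) :
    nu ends r s (assign ends T ρ) = ρ := by
  rw [nu, Bside_assign hno hρ hT, assign, flipTouch_flipTouch]

/-- `nu` of a `Sep`-colouring is a representative (no non-mark in both worlds). -/
lemma nu_mem_Rep {p q r s : V} {ω : Config E} (hno : NoNonmarkEdge ends p q r s)
    (h : sep2 ends p q r s ω) (hD : DZero ends r s ω) : nu ends r s ω ∈ Rep ends p q r s := by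
  obtain ⟨hC, hCr, hCs⟩ := subset_U2_of_subset_A0 (Bside_subset_A0 (ends := ends) r s ω)
  rw [mem_Rep, nu]
  refine ⟨sep2_flipTouch hno h hC hCr hCs, ?_⟩
  intro x hx
  rw [M2_flipTouch hno h hC hCr hCs] at hx
  rcases hx with ⟨hxM, hxB⟩ | ⟨hxB, hxK⟩
  · by_contra hx'
    exact hxB (mem_Bside.2 ⟨hxM, fun h1 => hx' (Or.inl h1), fun h2 => hx' (Or.inr h2)⟩)
  · obtain ⟨hxM, hr, hs⟩ := mem_Bside.1 hxB
    exact (hD x hr hs hxK hxM).elim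

/-- The `Sep`-colourings are fibred over the representatives by the side assignments. -/
theorem sum_sep_eq_sum_rep {p q r s : V} (hno : NoNonmarkEdge ends p q r s)
    (hD : ∀ ω, sep2 ends p q r s ω → DZero ends r s ω) (f : Config E → ℤ) :
    ∑ ω ∈ SepSet ends p q r s, f ω =
      ∑ ρ ∈ Rep ends p q r s, ∑ T ∈ (A0 ends r s ρ).powerset, f (assign ends T ρ) := by
  have hmaps : ∀ ω ∈ SepSet ends p q r s, nu ends r s ω ∈ Rep ends p q r s := fun ω hω =>
    nu_mem_Rep hno (mem_SepSet.1 hω) (hD ω (mem_SepSet.1 hω))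
  rw [← Finset.sum_fiberwise_of_maps_to hmaps]
  refine Finset.sum_congr rfl (fun ρ hρ => ?_)
  refine Finset.sum_nbij' (fun ω => Bside ends r s ω) (fun T => assign ends T ρ) ?_ ?_ ?_ ?_ ?_
  · intro ω hω
    rw [Finset.mem_filter] at hω
    obtain ⟨hωS, hων⟩ := hω
    rw [Finset.mem_powerset, ← hων, nu]
    have hB := subset_U2_of_subset_A0 (Bside_subset_A0 (ends := ends) r s ω)
    have hU := U2_flipTouch hno (mem_SepSet.1 hωS) hB.1 hB.2.1 hB.2.2
    intro x hx
    rw [mem_A0, hU]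
    exact mem_A0.1 (Bside_subset_A0 r s ω hx)
  · intro T hT
    rw [Finset.mem_powerset] at hT
    rw [Finset.mem_filter, mem_SepSet]
    exact ⟨sep2_assign hno (mem_Rep.1 hρ).1 hT, nu_assign hno hρ hT⟩
  · intro ω hω
    rw [Finset.mem_filter] at hω
    rw [← hω.2, nu, assign, flipTouch_flipTouch]
  · intro T hT
    exact Bside_assign hno hρ (Finset.mem_powerset.1 hT)
  · intro ω hω
    rw [Finset.mem_filter] at hω
    rw [← hω.2, nu, assign, flipTouch_flipTouch]

/-- The outside flip preserves the representatives. -/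
lemma flipIn_mem_Rep {p q r s : V} {ρ : Config E} (hρ : ρ ∈ Rep ends p q r s) :
    flipIn ends (Oset ends r s ρ) ρ ∈ Rep ends p q r s := by
  obtain ⟨h, hM⟩ := mem_Rep.1 hρ
  rw [mem_Rep, sep2_iff, K2_flipIn_Oset, M2_flipIn_Oset]
  exact ⟨sep2_iff.1 h, hM⟩

omit [Fintype E] [DecidableEq E] in
/-- `A0` is preserved by the outside flip. -/
lemma A0_flipIn_Oset (r s : V) (ω : Config E) :
    A0 ends r s (flipIn ends (Oset ends r s ω) ω) = A0 ends r s ω := by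
  ext x
  simp only [mem_A0, K2_flipIn_Oset, M2_flipIn_Oset]

omit [Fintype E] [DecidableEq E] in
/-- The outside is preserved by a side assignment. -/
lemma Oset_assign {p q r s : V} {ρ : Config E} (hno : NoNonmarkEdge ends p q r s)
    (h : sep2 ends p q r s ρ) {T : Finset V} (hT : T ⊆ A0 ends r s ρ) :
    Oset ends r s (assign ends T ρ) = Oset ends r s ρ := by
  obtain ⟨hC, hCr, hCs⟩ := subset_U2_of_subset_A0 hT
  simp only [Oset, assign]
  rw [U2_flipTouch hno h hC hCr hCs]


end Count

end SideSwitch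

end Summit.Ventures.PercRepro2
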